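import Mathlib
import HarnessLib
import Literature.MathematicalPhysics.QuantumLattice.TorusCentredMomentumLines
import Literature.MathematicalPhysics.QuantumLattice.HubbardUVSymbolFibreSampling

/-!
# CENTRED sampling of mixed lattice differences on the dual torus `(ℤ/L)²`: functions of the centred momentum `c⃗(k⃗) ∈ (-π,π]²`
# that vanish near the zone boundary

Topic `MathematicalPhysics/QuantumLattice`; continues `TorusCentredMomentumLines` (p3: no-wrap translation of the centred momentum
`torusCentredMomentum L (k⃗ + m e_l) = c⃗(k⃗) + (m·2π/L) e_l` within two steps, and the wrap ⇒ near-the-boundary lemmas) and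
`HubbardUVSymbolFibreSampling` (periodic sampling).  The scale-`0` sector MULTIPLIERS of Benfatto–Giuliani–Mastropietro 2006
(§2.5 (2.45)–(2.48): `F_ω(k) = C₀⁻¹(√(k₀² + e(k⃗)²))·ζ̃_{0,ω}(θ(k⃗))`) read the polar ANGLE of the centred momentum, which is not a
periodic function of the momentum; but they vanish near the zone boundary (there `|e| ≥ −μ − O(1/L²) > e₀`), so the mixed differences
`Δ_{e_l}^a Δ_{e_{l'}}^b` (`a, b ≤ 2`, `l ≠ l'`) of the samples `k⃗ ↦ Φ(c⃗(k⃗))` still ARE the samples of the continuum mixed differences —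
every term of the difference either sits at an unwrapped translate or vanishes on both sides:

* `cos_torusCentredMomentum_apply` (`cos c_l = cos p_l`), `torusCentredMomentum_add_apply_of_ne` (adding `e_{l'}` does not move `c_l`);
* `centred_step_or_vanish` — for `i ≤ 2`, `8 < L`: either `c⃗(k⃗ + i e_l) = c⃗(k⃗) + (i·2π/L)e_l`, or both `cos(c⃗(k⃗ + i e_l)_l)` and
  `cos(c_l(k⃗) + i·2π/L)` are `≤ −cos(4π/L)`;
* **`fwdDiff_iter₂_centred_eq`** — the sampling identity for `Φ` with `Φ(p) = 0` whenever `cos p_l ≤ −cos(4π/L)` for some `l`;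
* **`norm_fwdDiff_iter₂_centred_le`** — `‖Δ_{e_l}^aΔ_{e_{l'}}^b(Φ∘c⃗)(k⃗)‖ ≤ K·(2π/L)^{a+b}` from `‖D^{a+b}Φ‖ ≤ K` on the Euclidean plane.

Everything is proved; no definitions, no named facts.

## Sources

G. Benfatto, A. Giuliani, V. Mastropietro, Ann. Henri Poincaré 7 (2006) 809–898, §2.1 (2.1)–(2.3), §2.5 (2.45)–(2.48), Lemma 2.2
(2.36aa) (`BenfattoGiulianiMastropietro2006`).
-/

noncomputable section

namespace Literature.MathematicalPhysics.QuantumLattice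

open Real Finset Literature.Probability.LatticeModels Literature.Analysis.Calculus

variable {L : ℕ} [NeZero L]

/-! ### §1 Coordinates of the centred momentum -/

omit [NeZero L] in
/-- `cos c_l(k⃗) = cos p_l(k⃗)`: the centred coordinate differs from the lattice momentum by a multiple of `2π`.
[cite: BenfattoGiulianiMastropietro2006, §2.1 (2.1)] -/
theorem cos_torusCentredMomentum_apply (k : TorusSite 2 L) (i : Fin 2) :
    Real.cos (torusCentredMomentum L k i) = Real.cos (latticeMomentum L k i) := by
  rw [torusCentredMomentum, ← self_sub_toIocDiv_zsmul, zsmul_eq_mul, Real.cos_sub_int_mul_two_pi]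

omit [NeZero L] in
/-- Adding a multiple of `e_{l'}` does not change the `l`-coordinate (`l ≠ l'`). [cite: BenfattoGiulianiMastropietro2006, §2.1 (2.1)] -/
theorem add_smul_single_apply_of_ne (k : TorusSite 2 L) {l l' : Fin 2} (hll' : l ≠ l') (j : ℕ) :
    (k + j • (Pi.single l' (1 : ZMod L) : TorusSite 2 L)) l = k l := by
  simp [Pi.single_eq_of_ne hll']

omit [NeZero L] in
/-- The centred momentum is computed coordinatewise. [cite: BenfattoGiulianiMastropietro2006, §2.1 (2.1)] -/
theorem torusCentredMomentum_apply_eq_of_apply_eq {k k' : TorusSite 2 L} {l : Fin 2} (h : k l = k' l) :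
    torusCentredMomentum L k l = torusCentredMomentum L k' l := by
  simp only [torusCentredMomentum, latticeMomentum, h]

/-- The value of `(k⃗ + i e_l)_l` does not overflow when `2·val(k_l) ≤ L`, `i ≤ 2`, `8 < L`. [cite: BenfattoGiulianiMastropietro2006, §2.1 (2.1)] -/
theorem val_add_smul_single_of_le (k : TorusSite 2 L) (l : Fin 2) {i : ℕ} (hi : i ≤ 2) (hL : 8 < L)
    (hv : 2 * ((k l).val : ℤ) ≤ L) :
    ((k + i • (Pi.single l (1 : ZMod L) : TorusSite 2 L)) l).val = (k l).val + i := by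
  rw [nsmul_single_one, Pi.add_apply, Pi.single_eq_same, ZMod.val_add, ZMod.val_natCast, Nat.mod_eq_of_lt (a := i) (by omega),
    Nat.mod_eq_of_lt]
  omega

/-- **One direction, at most two steps: translate, or vanish on both sides.**  For `i ≤ 2` and `8 < L`: either
`c⃗(k⃗ + i e_l) = c⃗(k⃗) + (i·2π/L) e_l`, or `cos(c⃗(k⃗ + i e_l)_l) ≤ −cos(4π/L)` and `cos(c_l(k⃗) + i·2π/L) ≤ −cos(4π/L)`.
[cite: BenfattoGiulianiMastropietro2006, §2.1 (2.1)–(2.3)] -/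
theorem centred_step_or_vanish (hL : 8 < L) (k : TorusSite 2 L) (l : Fin 2) {i : ℕ} (hi : i ≤ 2) :
    torusCentredMomentum L (k + i • (Pi.single l (1 : ZMod L) : TorusSite 2 L)) =
        torusCentredMomentum L k + (i * (2 * π / L)) • (Pi.single l (1 : ℝ) : Fin 2 → ℝ) ∨
      (Real.cos (torusCentredMomentum L (k + i • (Pi.single l (1 : ZMod L) : TorusSite 2 L)) l) ≤ -Real.cos (4 * π / L) ∧
        Real.cos (torusCentredMomentum L k l + i * (2 * π / L)) ≤ -Real.cos (4 * π / L)) := by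
  by_cases hw : ((k l).valMinAbs + i) * 2 ≤ (L : ℤ)
  · exact Or.inl (torusCentredMomentum_add_smul_single k l i hw)
  · right
    have hw' : (L : ℤ) < ((k l).valMinAbs + i) * 2 := lt_of_not_ge hw
    have hbd := abs_two_mul_val_sub_le_of_wrap k l hi hL hw' i hi
    have hcos := cos_latticeMomentum_le_of_abs_sub_le (k + i • (Pi.single l (1 : ZMod L) : TorusSite 2 L)) l (by omega) hbd
    refine ⟨by rwa [cos_torusCentredMomentum_apply], ?_⟩
    -- the continuum coordinate `c_l + i·2π/L` is the lattice momentum of `k + i e_l` (no overflow of `val`)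
    obtain ⟨hvv, -, hhi⟩ := val_eq_valMinAbs_of_wrap (k l) hi (by omega) hw'
    have hval := val_add_smul_single_of_le k l hi hL hhi
    have hL0 : (0 : ℝ) < L := by exact_mod_cast (show 0 < L by omega)
    have hc : torusCentredMomentum L k l + i * (2 * π / L) =
        latticeMomentum L (k + i • (Pi.single l (1 : ZMod L) : TorusSite 2 L)) l := by
      rw [torusCentredMomentum_eq_valMinAbs,
        show latticeMomentum L (k + i • (Pi.single l (1 : ZMod L) : TorusSite 2 L)) l =
          2 * π * ((((k + i • (Pi.single l (1 : ZMod L) : TorusSite 2 L)) l).val : ℕ) : ℝ) / L from rfl, hval]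
      have hvv' : (((k l).valMinAbs : ℤ) : ℝ) = ((k l).val : ℝ) := by rw [← hvv]; push_cast; rfl
      simp only [hvv']
      push_cast
      field_simp
    rw [hc]
    exact hcos

/-! ### §2 The sampling identity -/

/-- **Termwise equality of the samples**: for `Φ` vanishing where `cos p_l ≤ −cos(4π/L)` for some `l`, `l ≠ l'`, `i, j ≤ 2`:
`Φ(c⃗(k⃗ + i e_l + j e_{l'})) = Φ(c⃗(k⃗) + (i·2π/L)e_l + (j·2π/L)e_{l'})`. [cite: BenfattoGiulianiMastropietro2006, §2.1 (2.3) and (2.36aa)] -/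
theorem centred_sample_two_dir_eq {G : Type*} (hL : 8 < L) (Φ : (Fin 2 → ℝ) → G) {z : G}
    (hvan : ∀ p : Fin 2 → ℝ, (∃ l : Fin 2, Real.cos (p l) ≤ -Real.cos (4 * π / L)) → Φ p = z)
    {l l' : Fin 2} (hll' : l ≠ l') {i j : ℕ} (hi : i ≤ 2) (hj : j ≤ 2) (k : TorusSite 2 L) :
    Φ (torusCentredMomentum L (k + i • (Pi.single l (1 : ZMod L) : TorusSite 2 L) + j • (Pi.single l' (1 : ZMod L) : TorusSite 2 L))) =
      Φ (torusCentredMomentum L k + (i * (2 * π / L)) • (Pi.single l (1 : ℝ) : Fin 2 → ℝ) +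
        (j * (2 * π / L)) • (Pi.single l' (1 : ℝ) : Fin 2 → ℝ)) := by
  set k₁ := k + i • (Pi.single l (1 : ZMod L) : TorusSite 2 L) with hk₁
  rcases centred_step_or_vanish hL k l hi with e1 | ⟨c1, c1'⟩
  · rcases centred_step_or_vanish hL k₁ l' hj with e2 | ⟨c2, c2'⟩
    · rw [e2, e1]
    · -- wrap in the direction `l'`: both samples vanish
      have hk₁l' : torusCentredMomentum L k₁ l' = torusCentredMomentum L k l' :=
        torusCentredMomentum_apply_eq_of_apply_eq (add_smul_single_apply_of_ne k (Ne.symm hll') i)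
      rw [hvan _ ⟨l', c2⟩, hvan _ ⟨l', ?_⟩]
      simpa [Pi.single_eq_of_ne (Ne.symm hll'), hk₁l'] using c2'
  · -- wrap in the direction `l`: both samples vanish
    have hk₂l : torusCentredMomentum L (k₁ + j • (Pi.single l' (1 : ZMod L) : TorusSite 2 L)) l = torusCentredMomentum L k₁ l :=
      torusCentredMomentum_apply_eq_of_apply_eq (add_smul_single_apply_of_ne k₁ hll' j)
    rw [hvan _ ⟨l, by rw [hk₂l]; exact c1⟩, hvan _ ⟨l, ?_⟩]
    simpa [Pi.single_eq_of_ne hll'] using c1'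

/-- **The centred sampling identity**: for `Φ` vanishing near the zone boundary (where `cos p_l ≤ −cos(4π/L)` for some `l`), `l ≠ l'`,
`a, b ≤ 2`, `8 < L`: the torus mixed difference of the samples is the sample of the continuum mixed difference,
`Δ_{e_l}^a Δ_{e_{l'}}^b (Φ∘c⃗)(k⃗) = (Δ_{(2π/L)e_l}^a Δ_{(2π/L)e_{l'}}^b Φ)(c⃗(k⃗))`. [cite: BenfattoGiulianiMastropietro2006, (2.36aa)] -/
theorem fwdDiff_iter₂_centred_eq {G : Type*} [AddCommGroup G] (hL : 8 < L) (Φ : (Fin 2 → ℝ) → G)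
    (hvan : ∀ p : Fin 2 → ℝ, (∃ l : Fin 2, Real.cos (p l) ≤ -Real.cos (4 * π / L)) → Φ p = 0)
    {l l' : Fin 2} (hll' : l ≠ l') {a b : ℕ} (ha : a ≤ 2) (hb : b ≤ 2) (k : TorusSite 2 L) :
    (fwdDiff (Pi.single l (1 : ZMod L) : TorusSite 2 L))^[a]
        ((fwdDiff (Pi.single l' (1 : ZMod L) : TorusSite 2 L))^[b] (fun k => Φ (torusCentredMomentum L k))) k =
      ((fwdDiff ((2 * π / L) • (Pi.single l (1 : ℝ) : Fin 2 → ℝ)))^[a]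
        ((fwdDiff ((2 * π / L) • (Pi.single l' (1 : ℝ) : Fin 2 → ℝ)))^[b] Φ)) (torusCentredMomentum L k) := by
  rw [fwdDiff_iter_eq_sum_shift, fwdDiff_iter_eq_sum_shift]
  refine sum_congr rfl fun i hi => ?_
  have hi' : i ≤ 2 := (Nat.lt_succ_iff.1 (mem_range.1 hi)).trans ha
  congr 1
  rw [fwdDiff_iter_eq_sum_shift, fwdDiff_iter_eq_sum_shift]
  refine sum_congr rfl fun j hj => ?_
  have hj' : j ≤ 2 := (Nat.lt_succ_iff.1 (mem_range.1 hj)).trans hb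
  congr 1
  rw [centred_sample_two_dir_eq hL Φ hvan hll' hi' hj' k, ← Nat.cast_smul_eq_nsmul ℝ i, ← Nat.cast_smul_eq_nsmul ℝ j,
    smul_smul, smul_smul]

/-! ### §3 The norm bound -/

/-- **Centred-sampled mixed differences are bounded by the derivative sup**: `‖Δ_{e_l}^aΔ_{e_{l'}}^b(Φ∘c⃗)(k⃗)‖ ≤ K·(2π/L)^{a+b}` when
`Φ` is `C^{a+b}` on the Euclidean plane with `‖D^{a+b}Φ‖ ≤ K` and `Φ(p) = 0` wherever `cos p_l ≤ −cos(4π/L)` for some `l`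
(`a, b ≤ 2`, `l ≠ l'`, `8 < L`). [cite: BenfattoGiulianiMastropietro2006, (2.36aa)] -/
theorem norm_fwdDiff_iter₂_centred_le {F : Type*} [NormedAddCommGroup F] [NormedSpace ℝ F] (hL : 8 < L)
    (Φ : EuclideanSpace ℝ (Fin 2) → F)
    (hvan : ∀ p : Fin 2 → ℝ, (∃ l : Fin 2, Real.cos (p l) ≤ -Real.cos (4 * π / L)) → Φ (WithLp.toLp 2 p) = 0)
    {a b : ℕ} (ha : a ≤ 2) (hb : b ≤ 2) (hΦ : ContDiff ℝ (↑(a + b : ℕ)) Φ) {K : ℝ} (hK : ∀ x, ‖iteratedFDeriv ℝ (a + b) Φ x‖ ≤ K)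
    {l l' : Fin 2} (hll' : l ≠ l') (k : TorusSite 2 L) :
    ‖(fwdDiff (Pi.single l (1 : ZMod L) : TorusSite 2 L))^[a]
        ((fwdDiff (Pi.single l' (1 : ZMod L) : TorusSite 2 L))^[b]
          (fun k => Φ (WithLp.toLp 2 (torusCentredMomentum L k)))) k‖ ≤ K * (2 * π / L) ^ (a + b) := by
  rw [fwdDiff_iter₂_centred_eq hL (fun p => Φ (WithLp.toLp 2 p)) hvan hll' ha hb k, fwdDiff_iter_comp_toLp _ b Φ,
    fwdDiff_iter_comp_toLp _ a]
  have h := norm_fwdDiff_iter_fwdDiff_iter_le (WithLp.toLp 2 ((2 * π / L) • (Pi.single l (1 : ℝ) : Fin 2 → ℝ)))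
    (WithLp.toLp 2 ((2 * π / L) • (Pi.single l' (1 : ℝ) : Fin 2 → ℝ))) a b hΦ hK (WithLp.toLp 2 (torusCentredMomentum L k))
  rw [norm_toLp_step, norm_toLp_step, mul_assoc, ← pow_add] at h
  exact h

end Literature.MathematicalPhysics.QuantumLattice

end
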